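/-
Copyright (c) 2026 the pub-hodgecm-mathlib formalisation cell (harness21).  Prover seat hodgecm-mathlib-F0P3-p02 (g27), 2026-09-03.  E1 row 63 «(d1)+(d2a′) DISCHARGE: REALISE +
SCHUR-PAIR + `r_P(quotient) ≠ 0`» (E1 keeper ∕ dealer F0P3a-p03 (g30) 03:50:03Z ∕ 03:54:44Z «= ×11 + = cut»; census `CENSUS-R62-d1.v1` 67e2c6de (F0P3a-p06 g25); sigsheet
`SIG-R63.v1` ce55563c).
-/
import Literature.NumberTheory.Automorphic.JacquetLengthTwoLabelsEmb               -- ★ LABELS (F0P3-p02 g8): `labelledPair_exists_of_line_normalizedInd`, `jacquetMap_equiv_injective`; brings ★ JH-PAIR-RANKS (`ConstituentsOfExtension`), `IrrClass`, `normalizedJacquet`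
import Literature.NumberTheory.Automorphic.JacquetNonzeroEmbedsNormalizedInd       -- ★ FROBENIUS `Representation.exists_injective_intertwiningMap_normalizedInd_of_ne_zero`
import Literature.NumberTheory.Automorphic.ConstituentPairFixedRank                -- ★ JH-PAIR-RANKS `IrrClass.exists_ne_bot_ne_top_of_constituents_pair`
import Literature.NumberTheory.Automorphic.RestrictedTensorProductIrreducibleProofs -- ★ admissible Schur `Representation.IsAdmissible.exists_eq_smul_id`
import Literature.NumberTheory.Automorphic.AdmissibleSubquotient                   -- ★ `Representation.IsAdmissible.toRepresentation`, `IsSmooth.toRepresentation`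
import HarnessLib

/-!
# The image of an irreducible under an injective intertwiner, the Schur pair of a length-two representation with distinct constituents, and the realisation
# `π ↪ i_P(𝟙 ⊗ θ)` from `r_P(π) ≅ 𝟙 ⊗ θ` (Casselman 1995, Thm 3.2.4, Cor. 6.3.9, Cor. 7.1.2; Bernstein–Zelevinsky 1977, Prop. 1.9 (b))

Topic `NumberTheory/Automorphic`; §1 and the generic Schur count in the `Representation` namespace (dot notation), §2–§4 next to ★ `IrrClass` in
`Literature.NumberTheory.Automorphic.IrrClass`.  THEOREMS ONLY (no definition, no instance, no notation, no named fact, no `sorry`).  Cell `pub/hodgecm-mathlib` (D-0151), crux H413 =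
`stmt-HodgeConjecture-24833`, lane `--supports`; E1 BRICK LEDGER row 63: the discharge of the letters `(A hAinv hAirr hHom0 hSchur)` of ★ 40″ K2′-π² SENTENCE
`F0P3cStCharTSK2PiTwoSelfExtSplitSentence.selfExtension_splits_of_jacquet_selfExtension` ((d1) «`A = π²(ξ)` is an invariant irreducible submodule of `I₀ = i_P(χ₁)` with
`Hom_G(A, I₀∕A) = 0` and `dim End_G(A) = 1`») and of (d2a′) «`r_P(I₀∕A) ≠ 0`» (census R59), from ★ LABELS' output shape — GENERIC: abstract smooth representations (§1–§2) and an
abstract parabolic triple (§3–§4); the CM datum application is one term-mode call (row 63 rider `Theorems/F0P3cStCharTSPiTwoRealisation.lean`).  HONEST LABEL: count-neutral helper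
layer; (R-SS) banked PAYDOWN-UNR for K1 only; E1 = PRINT until the keeper's charter test; HC_CM is proved only modulo the printed citations (hLiu418 = `stmt-HodgeConjecture-24832`,
h413 = `stmt-HodgeConjecture-24833`) until rung 0 closes; nothing printed is asserted here.

THE MATHEMATICS.  (§1) The image `A = f(π)` of an irreducible `π` under an injective intertwiner `f : π ↪ ρ` is `G`-stable, `ρ|_A ≅ π` is irreducible, and every `G`-stable `B ≤ A` is
`0` or `A` [BushnellHenniart2006 §1.1].  (§2) If `ρ` is smooth of length two (no `3`-chains of subrepresentations) with constituents exactly `{a, b}`, `a ≠ b`, then `A ≠ 0, ρ`,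
the quotient `ρ∕A` is irreducible (★ JH-PAIR-RANKS), the classes are `⟦ρ|_A⟧ = a ⇒ ⟦ρ∕A⟧ = b` (★ `isConstituentOf_iff_of_isIrreducible`), hence `Hom_G(ρ|_A, ρ∕A) = 0` (a non-zero map
of irreducibles is an isomorphism [Casselman1995 §7.1]); and `dim End_G(σ) = 1` for every admissible irreducible `σ` over `ℂ` (★ admissible Schur [Bump1997 Prop. 4.2.4]).  (§3) For a
parabolic triple `t = (P, M, N)` with `δ_P|_N = 1`: an `M`-equivalence `r_P(π) ≅ ℂ_θ` is a non-zero `M`-map, so Frobenius reciprocity embeds `π ↪ i_P(ℂ_θ)` (★ FROBENIUS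
[BernsteinZelevinsky1977 Prop. 1.9 (b); Casselman1995 Thm 3.2.4]); and `r_P` of a representation in a class `πn` with `r_P(πn) ≅ ℂ_{θ₁}` is non-zero.  (§4) THE PACKAGE: for
`I₀ := i_P(ℂ_{θ₂})` smooth admissible of length two with constituents `{πn, πs}`, `πs ≠ πn`, `r_P(πs) ≅ ℂ_{θ₂}`, `r_P(πn) ≅ ℂ_{θ₁}`: there is `A ≤ I₀` with `hAinv hAirr hHom0 hSchur`,
`⟦I₀|_A⟧ = πs`, `⟦I₀∕A⟧ = πn` and `r_P(I₀∕A) ≠ 0`.  ORIENTATION (census R62 §1; ★ `JacquetLineQuotientCharacter`): in ★ LABELS' letters `θ₂` is the QUOTIENT character of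
`r_P(i_P σ)`; the file decides nothing about it — the length ∕ constituent data `hlen hJH` of the TARGET `I₀` are hypotheses (★ LABELS' own conclusion when `σ = 𝟙 ⊗ θ₂`).

* §1 `range_le_comap_of_intertwiningMap`, `nonempty_equiv_subrepresentation_range`, `isIrreducible_subrepresentation_range`, `forall_le_range_eq_bot_or_eq` (= `hAirr`),
  `finrank_intertwiningMap_self_eq_one_of_isAdmissible` (= `hSchur`, generic).
* §2 `isIrreducible_quotient_of_forall_not_lt_lt`, `range_ne_bot_of_injective`, `range_ne_top_of_constituents_pair`, `mk_quotient_eq_of_mk_subrepresentation_eq`,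
  **`intertwiningMap_subrepresentation_quotient_eq_zero`** (= `hHom0`), `finrank_intertwiningMap_subrepresentation_self_eq_one` (= `hSchur` at `ρ|_A`).
* §3 **`exists_injective_intertwiningMap_normalizedInd_of_normalizedJacquet_equiv`** (REALISE), `nontrivial_coinvariants_quotient_of_mk_eq` ((d2a′)).
* §4 **`exists_realisation_schurPair`** — one call for the consumer (row 59 datum half ∕ the rider).

## References
* [Casselman1995] W. Casselman, *Introduction to the theory of admissible representations of p-adic reductive groups* (1995): Thm 3.2.4 (Frobenius reciprocity), Cor. 6.3.9,
  Cor. 7.1.2, §7.1.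
* [BernsteinZelevinsky1977] I. N. Bernstein, A. V. Zelevinsky, *Induced representations of reductive p-adic groups I*, Ann. Sci. ÉNS 10 (1977): Prop. 1.9 (b), §2.3.
* [BushnellHenniart2006] C. J. Bushnell, G. Henniart, *The local Langlands conjecture for GL(2)* (2006): §1.1 (Irr(G), subquotients), §2.
* [Bump1997] D. Bump, *Automorphic Forms and Representations* (1997): Proposition 4.2.4 (Schur's lemma for admissible irreducibles).
-/

set_option autoImplicit false

noncomputable section

open Function

/-! ## §1 The image of an irreducible under an injective intertwiner; the Schur count of an admissible irreducible -/

namespace Representation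

section Image

variable {k G V X : Type*} [Field k] [Group G] [AddCommGroup V] [Module k V] [AddCommGroup X] [Module k X]
  {ρ : Representation k G V} {π : Representation k G X}

/-- The image of an intertwiner is `G`-stable: `f(π) ≤ f(π).comap (ρ g)` (the letter `hAinv`). [cite: BushnellHenniart2006, §1.1] -/
theorem range_le_comap_of_intertwiningMap (f : π.IntertwiningMap ρ) (g : G) :
    LinearMap.range f.toLinearMap ≤ (LinearMap.range f.toLinearMap).comap (ρ g) := by
  rintro _ ⟨x, rfl⟩
  exact ⟨π g x, by rw [IntertwiningMap.toLinearMap_apply, IntertwiningMap.toLinearMap_apply, IntertwiningMap.isIntertwining _ _ f g x]⟩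

/-- **`π ≅ ρ|_{f(π)}`** for an injective intertwiner `f : π ↪ ρ`. [cite: BushnellHenniart2006, §1.1] -/
theorem nonempty_equiv_subrepresentation_range (f : π.IntertwiningMap ρ) (hf : Injective f) :
    Nonempty (π.Equiv (ρ.subrepresentation (LinearMap.range f.toLinearMap) (range_le_comap_of_intertwiningMap f))) := by
  let e : X ≃ₗ[k] LinearMap.range f.toLinearMap := LinearEquiv.ofInjective f.toLinearMap hf
  refine ⟨Representation.Equiv.mk e fun g => LinearMap.ext fun x => Subtype.ext ?_⟩
  change f (π g x) = ρ g (f x)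
  exact IntertwiningMap.isIntertwining _ _ f g x

/-- **The image of an irreducible under an injective intertwiner is irreducible** (transport along §1 `π ≅ ρ|_{f(π)}`). [cite: BushnellHenniart2006, §1.1] -/
theorem isIrreducible_subrepresentation_range [π.IsIrreducible] (f : π.IntertwiningMap ρ) (hf : Injective f) :
    (ρ.subrepresentation (LinearMap.range f.toLinearMap) (range_le_comap_of_intertwiningMap f)).IsIrreducible := by
  obtain ⟨e⟩ := nonempty_equiv_subrepresentation_range f hf
  exact e.isIrreducible

/-- **`hAirr`: every `G`-stable `B ≤ f(π)` is `0` or `f(π)`** for `π` irreducible (pull `B` back to a subrepresentation of `π`; no injectivity needed). [cite: BushnellHenniart2006, §1.1]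
[cite: Casselman1995, §7.1] -/
theorem forall_le_range_eq_bot_or_eq [π.IsIrreducible] (f : π.IntertwiningMap ρ) (B : Submodule k V) (hB : B ≤ LinearMap.range f.toLinearMap)
    (hBinv : ∀ g, B ≤ B.comap (ρ g)) : B = ⊥ ∨ B = LinearMap.range f.toLinearMap := by
  -- the pull-back `f⁻¹ B` is a subrepresentation of `π`
  let N : Subrepresentation π := ⟨B.comap f.toLinearMap, fun g x hx => by
    change f (π g x) ∈ B
    rw [IntertwiningMap.isIntertwining _ _ f g x]
    exact hBinv g hx⟩
  have hmap : (B.comap f.toLinearMap).map f.toLinearMap = B := Submodule.map_comap_eq_of_le hB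
  rcases IsSimpleOrder.eq_bot_or_eq_top N with hN | hN
  · left
    have h1 : B.comap f.toLinearMap = ⊥ := congrArg Subrepresentation.toSubmodule hN
    rw [← hmap, h1, Submodule.map_bot]
  · right
    have h1 : B.comap f.toLinearMap = ⊤ := congrArg Subrepresentation.toSubmodule hN
    rw [← hmap, h1, Submodule.map_top]

end Image

section Schur

variable {G W : Type*} [Group G] [TopologicalSpace G] [SeparatelyContinuousMul G] [AddCommGroup W] [Module ℂ W] {σ : Representation ℂ G W}

/-- **`hSchur`: `dim_ℂ End_G(σ) = 1` for an ADMISSIBLE IRREDUCIBLE `σ`** (★ admissible Schur `IsAdmissible.exists_eq_smul_id` at a compact open `K`: every `G`-endomorphism is a scalar,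
so `c ↦ c • id : ℂ ≃ End_G(σ)`). [cite: Bump1997, Proposition 4.2.4] [cite: Casselman1995, §7.1] -/
theorem finrank_intertwiningMap_self_eq_one_of_isAdmissible [σ.IsIrreducible] (hσ : σ.IsAdmissible) {K : Subgroup G} (hKo : IsOpen (K : Set G))
    (hKc : IsCompact (K : Set G)) : Module.finrank ℂ (IntertwiningMap σ σ) = 1 := by
  haveI : Nontrivial W := IsIrreducible.nontrivial σ
  let φ : ℂ →ₗ[ℂ] IntertwiningMap σ σ := LinearMap.toSpanSingleton ℂ (IntertwiningMap σ σ) (IntertwiningMap.id σ)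
  have hφ : ∀ c : ℂ, φ c = c • IntertwiningMap.id σ := fun c => LinearMap.toSpanSingleton_apply ℂ (IntertwiningMap σ σ) _ c
  have hbij : Bijective φ := by
    constructor
    · intro c c' h
      obtain ⟨w, hw⟩ := exists_ne (0 : W)
      have h1 : (φ c) w = (φ c') w := by rw [h]
      rw [hφ, hφ, IntertwiningMap.smul_apply, IntertwiningMap.smul_apply, IntertwiningMap.id_apply] at h1
      exact smul_left_injective ℂ hw h1
    · intro T
      obtain ⟨c, hc⟩ := hσ.exists_eq_smul_id hKo hKc T.toLinearMap fun g => T.isIntertwining' g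
      refine ⟨c, ?_⟩
      rw [hφ]
      refine IntertwiningMap.ext (LinearMap.ext fun w => ?_)
      rw [IntertwiningMap.toLinearMap_smul, hc]
      rfl
  rw [← (LinearEquiv.ofBijective φ hbij).finrank_eq, Module.finrank_self]

end Schur

section Quotient

variable {G V : Type*} [Group G] [AddCommGroup V] [Module ℂ V] {ρ : Representation ℂ G V}

/-- **`ρ∕A` is irreducible** for a `G`-stable `0 ≠ A ≠ V` of a `ρ` without `3`-chains of subrepresentations (★ JH-PAIR-RANKS `isIrreducible_quotientRep_of_forall_not_lt_lt`, read on
Mathlib's `Representation.quotient`). [cite: Casselman1995, Cor. 7.1.2] [cite: BushnellHenniart2006, §1.1] -/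
theorem isIrreducible_quotient_of_forall_not_lt_lt (hlen : ∀ N₁ N₂ : Subrepresentation ρ, ¬ (⊥ < N₁ ∧ N₁ < N₂ ∧ N₂ < ⊤)) (A : Submodule ℂ V)
    (hAinv : ∀ g, A ≤ A.comap (ρ g)) (hb : A ≠ ⊥) (ht : A ≠ ⊤) : (ρ.quotient A hAinv).IsIrreducible := by
  let N : Subrepresentation ρ := ⟨A, fun g _ hv => hAinv g hv⟩
  have hNb : N ≠ ⊥ := fun h => hb (congrArg Subrepresentation.toSubmodule h)
  have hNt : N ≠ ⊤ := fun h => ht (congrArg Subrepresentation.toSubmodule h)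
  have h := Literature.NumberTheory.Automorphic.IrrClass.isIrreducible_quotientRep_of_forall_not_lt_lt hlen hNb hNt
  exact h

end Quotient

section Realise

variable {G : Type*} [Group G] [TopologicalSpace G] [IsTopologicalGroup G] (t : Literature.NumberTheory.Automorphic.ParabolicTriple G) [LocallyCompactSpace t.P]
  {X : Type*} [AddCommGroup X] [Module ℂ X] (π : Representation ℂ G X)

/-- **REALISE: `r_P(π) ≅ ℂ_θ ⇒ π ↪ i_P(ℂ_θ)`** for `π` irreducible smooth and `δ_P|_N = 1`: the equivalence is a NON-ZERO `M`-map `r_P(π) → ℂ_θ` (it hits `1`), and ★ FROBENIUS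
`exists_injective_intertwiningMap_normalizedInd_of_ne_zero` embeds. [cite: BernsteinZelevinsky1977, Prop. 1.9 (b)] [cite: Casselman1995, Thm 3.2.4] -/
theorem exists_injective_intertwiningMap_normalizedInd_of_normalizedJacquet_equiv [π.IsIrreducible] (hπ : π.IsSmooth)
    (hδ : ∀ (n : G) (hn : n ∈ t.N), Literature.NumberTheory.Automorphic.deltaChar t.P ⟨n, t.N_le hn⟩ = 1) {θ : ↥t.M →* ℂˣ}
    (e : (π.normalizedJacquet t).Equiv ((Representation.trivial ℂ ↥t.M ℂ).twist θ)) :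
    ∃ f : π.IntertwiningMap (normalizedInd t ((Representation.trivial ℂ ↥t.M ℂ).twist θ)), Injective f := by
  refine π.exists_injective_intertwiningMap_normalizedInd_of_ne_zero t hπ hδ _ e.toIntertwiningMap fun h => ?_
  have h1 : e (e.symm (1 : ℂ)) = (1 : ℂ) := e.apply_symm_apply 1
  have h2 : e (e.symm (1 : ℂ)) = (0 : ℂ) := by
    change e.toIntertwiningMap (e.symm (1 : ℂ)) = 0
    rw [h]
    rfl
  exact one_ne_zero (h1.symm.trans h2)

end Realise

end Representation

/-! ## §2 The Schur pair of a length-two representation with distinct constituents -/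

namespace Literature.NumberTheory.Automorphic

namespace IrrClass

open _root_.Representation

variable {G : Type} [Group G] [TopologicalSpace G] [IsTopologicalGroup G]

omit [TopologicalSpace G] [IsTopologicalGroup G] in
/-- The image of a non-zero irreducible under an injective intertwiner is non-zero. [cite: BushnellHenniart2006, §1.1] -/
theorem range_ne_bot_of_injective {V X : Type} [AddCommGroup V] [Module ℂ V] [AddCommGroup X] [Module ℂ X] {ρ : Representation ℂ G V} {π : Representation ℂ G X}
    [π.IsIrreducible] (f : π.IntertwiningMap ρ) (hf : Injective f) : LinearMap.range f.toLinearMap ≠ ⊥ := by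
  haveI : Nontrivial X := Representation.IsIrreducible.nontrivial π
  obtain ⟨x, hx⟩ := exists_ne (0 : X)
  intro h
  have hfx : f x ∈ LinearMap.range f.toLinearMap := ⟨x, rfl⟩
  rw [h, Submodule.mem_bot] at hfx
  exact hx (hf (by rw [hfx, map_zero]))

omit [IsTopologicalGroup G] in
/-- **The image of an irreducible in a representation with TWO DISTINCT constituents is a PROPER submodule**: were `f(π) = V`, `ρ ≅ π` would be irreducible, but a `ρ` with
constituents exactly `a ≠ b` has a `G`-stable `0 ≠ N ≠ V` (★ `exists_ne_bot_ne_top_of_constituents_pair`). [cite: Casselman1995, §7.1] [cite: BushnellHenniart2006, §2] -/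
theorem range_ne_top_of_constituents_pair {V X : Type} [AddCommGroup V] [Module ℂ V] [AddCommGroup X] [Module ℂ X] {ρ : Representation ℂ G V} {π : Representation ℂ G X}
    [π.IsIrreducible] {a b : IrrClass G} (hJH : ∀ c : IrrClass G, c.IsConstituentOf ρ ↔ (c = a ∨ c = b)) (hab : a ≠ b)
    (f : π.IntertwiningMap ρ) (hf : Injective f) : LinearMap.range f.toLinearMap ≠ ⊤ := by
  intro htop
  have hsurj : Surjective f := fun v => by
    have hv : v ∈ LinearMap.range f.toLinearMap := by rw [htop]; exact Submodule.mem_top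
    exact hv
  haveI : ρ.IsIrreducible := (f.ofBijective ⟨hf, hsurj⟩).isIrreducible
  obtain ⟨N, hNb, hNt⟩ := exists_ne_bot_ne_top_of_constituents_pair hJH hab
  rcases IsSimpleOrder.eq_bot_or_eq_top N with h | h
  · exact hNb h
  · exact hNt h

/-- **THE LABELS OF THE PAIR: `⟦ρ|_A⟧ = a ⇒ ⟦ρ∕A⟧ = b`** for a smooth `ρ` whose constituents are exactly `a ≠ b`, `A` `G`-stable with `ρ|_A` and `ρ∕A` irreducible (★
`isConstituentOf_iff_of_isIrreducible`: the constituents are exactly `⟦ρ∕A⟧`, `⟦ρ|_A⟧`). [cite: Casselman1995, Cor. 7.1.2] [cite: BushnellHenniart2006, §2] -/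
theorem mk_quotient_eq_of_mk_subrepresentation_eq {V : Type} [AddCommGroup V] [Module ℂ V] {ρ : Representation ℂ G V} (hρ : ρ.IsSmooth)
    {a b : IrrClass G} (hJH : ∀ c : IrrClass G, c.IsConstituentOf ρ ↔ (c = a ∨ c = b)) (hab : a ≠ b)
    (A : Submodule ℂ V) (hAinv : ∀ g, A ≤ A.comap (ρ g)) (hirrA : (ρ.subrepresentation A hAinv).IsIrreducible) (hsmA : (ρ.subrepresentation A hAinv).IsSmooth)
    (hirrQ : (ρ.quotient A hAinv).IsIrreducible) (hsmQ : (ρ.quotient A hAinv).IsSmooth)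
    (ha : IrrClass.mk (SmoothIrrep.mk ↥A (ρ.subrepresentation A hAinv) hirrA hsmA) = a) :
    IrrClass.mk (SmoothIrrep.mk (V ⧸ A) (ρ.quotient A hAinv) hirrQ hsmQ) = b := by
  let N : Subrepresentation ρ := ⟨A, fun g _ hv => hAinv g hv⟩
  have key := isConstituentOf_iff_of_isIrreducible hρ N hirrA hirrQ
  have hb : b.IsConstituentOf ρ := (hJH b).2 (Or.inr rfl)
  rcases (key b).1 hb with h | h
  · exact h.symm
  · exact absurd (ha.symm.trans h.symm) hab

omit [IsTopologicalGroup G] in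
/-- **`hHom0`: `Hom_G(ρ|_A, ρ∕A) = 0`** when `ρ|_A` and `ρ∕A` are irreducible with DIFFERENT classes: a non-zero intertwiner of irreducibles is bijective (Mathlib
`IsIrreducible.bijective_or_eq_zero`), hence an equivalence, hence equal classes. [cite: Casselman1995, §7.1] [cite: BushnellHenniart2006, §1.1] -/
theorem intertwiningMap_subrepresentation_quotient_eq_zero {V : Type} [AddCommGroup V] [Module ℂ V] {ρ : Representation ℂ G V}
    (A : Submodule ℂ V) (hAinv : ∀ g, A ≤ A.comap (ρ g)) (hirrA : (ρ.subrepresentation A hAinv).IsIrreducible) (hsmA : (ρ.subrepresentation A hAinv).IsSmooth)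
    (hirrQ : (ρ.quotient A hAinv).IsIrreducible) (hsmQ : (ρ.quotient A hAinv).IsSmooth)
    (hne : IrrClass.mk (SmoothIrrep.mk ↥A (ρ.subrepresentation A hAinv) hirrA hsmA) ≠ IrrClass.mk (SmoothIrrep.mk (V ⧸ A) (ρ.quotient A hAinv) hirrQ hsmQ))
    (ψ : IntertwiningMap (ρ.subrepresentation A hAinv) (ρ.quotient A hAinv)) : ψ = 0 := by
  haveI := hirrA
  haveI := hirrQ
  rcases IsIrreducible.bijective_or_eq_zero ψ with h | h
  · exact absurd (IrrClass.mk_eq_mk_of_equiv (r₁ := SmoothIrrep.mk ↥A (ρ.subrepresentation A hAinv) hirrA hsmA)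
      (r₂ := SmoothIrrep.mk (V ⧸ A) (ρ.quotient A hAinv) hirrQ hsmQ) (ψ.ofBijective h)) hne
  · exact h

/-- **`hSchur` at `ρ|_A`: `dim_ℂ End_G(ρ|_A) = 1`** for `ρ` admissible and `ρ|_A` irreducible (★ `IsAdmissible.toRepresentation` + §1
`finrank_intertwiningMap_self_eq_one_of_isAdmissible`). [cite: Bump1997, Proposition 4.2.4] [cite: Casselman1995, §7.1] -/
theorem finrank_intertwiningMap_subrepresentation_self_eq_one {V : Type} [AddCommGroup V] [Module ℂ V] {ρ : Representation ℂ G V} (hadm : ρ.IsAdmissible)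
    {K : Subgroup G} (hKo : IsOpen (K : Set G)) (hKc : IsCompact (K : Set G))
    (A : Submodule ℂ V) (hAinv : ∀ g, A ≤ A.comap (ρ g)) (hirrA : (ρ.subrepresentation A hAinv).IsIrreducible) :
    Module.finrank ℂ (IntertwiningMap (ρ.subrepresentation A hAinv) (ρ.subrepresentation A hAinv)) = 1 := by
  let N : Subrepresentation ρ := ⟨A, fun g _ hv => hAinv g hv⟩
  haveI : N.toRepresentation.IsIrreducible := hirrA
  exact finrank_intertwiningMap_self_eq_one_of_isAdmissible (σ := N.toRepresentation) (hadm.toRepresentation N) hKo hKc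

/-! ## §3 At a parabolic triple: (d2a′) `r_P(ρ∕A) ≠ 0` from the class of the quotient -/

/-- **(d2a′) `r_P(ρ∕A) ≠ 0`**: if `⟦ρ∕A⟧ = πn` and some representative of `πn` has `r_P ≅ ℂ_{θ₁}` (★ LABELS' fourth conjunct), then the coinvariants of `ρ∕A` are non-trivial
(transport along the class equivalence, ★ `jacquetMap_equiv_injective`). [cite: Casselman1995, Thm 3.2.4] [cite: BernsteinZelevinsky1977, §2.3] -/
theorem nontrivial_coinvariants_quotient_of_mk_eq (t : ParabolicTriple G) [LocallyCompactSpace t.P] {V : Type} [AddCommGroup V] [Module ℂ V] {ρ : Representation ℂ G V}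
    (A : Submodule ℂ V) (hAinv : ∀ g, A ≤ A.comap (ρ g)) (hirrQ : (ρ.quotient A hAinv).IsIrreducible) (hsmQ : (ρ.quotient A hAinv).IsSmooth)
    {πn : IrrClass G} (hq : IrrClass.mk (SmoothIrrep.mk (V ⧸ A) (ρ.quotient A hAinv) hirrQ hsmQ) = πn) {θ₁ : ↥t.M →* ℂˣ}
    (hn : ∃ r : SmoothIrrep G, IrrClass.mk r = πn ∧ Nonempty ((r.ρ.normalizedJacquet t).Equiv ((Representation.trivial ℂ ↥t.M ℂ).twist θ₁))) :
    Nontrivial (t.restrict (ρ.quotient A hAinv)).Coinvariants := by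
  obtain ⟨r, hr, ⟨e⟩⟩ := hn
  obtain ⟨e'⟩ := (IrrClass.mk_eq_mk_iff r (SmoothIrrep.mk (V ⧸ A) (ρ.quotient A hAinv) hirrQ hsmQ)).1 (hr.trans hq.symm)
  -- `r_P(r) ≅ ℂ` is non-trivial
  haveI : Nontrivial (t.restrict r.ρ).Coinvariants :=
    (show Injective (e.symm : ℂ → (t.restrict r.ρ).Coinvariants) from e.symm.toLinearEquiv.injective).nontrivial
  exact (jacquetMap_equiv_injective t e').nontrivial

/-! ## §4 The package: REALISE + SCHUR-PAIR + (d2a′) in `I₀ = i_P(ℂ_{θ₂})` -/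

/-- **ROW 63 — REALISATION AND SCHUR PAIR.**  `t` a parabolic triple with `δ_P|_N = 1`, `I₀ := i_P(ℂ_{θ₂}) = normalizedInd t (𝟙 ⊗ θ₂)` SMOOTH ADMISSIBLE of length two (no `3`-chains) with
constituents exactly `{πn, πs}`, `πs ≠ πn`, and ★ LABELS' data «`r_P(πs) ≅ ℂ_{θ₂}`, `r_P(πn) ≅ ℂ_{θ₁}`» (for representatives), `K` a compact open subgroup (for Schur).  THEN there is a
`G`-stable `A ≤ I₀` — the image of `πs ↪ I₀` (§3 REALISE) — with: (`hAirr`) every `G`-stable `B ≤ A` is `0` or `A`; (`hHom0`) `Hom_G(I₀|_A, I₀∕A) = 0`; (`hSchur`) `dim End_G(I₀|_A) = 1`;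
`⟦I₀|_A⟧ = πs`, `⟦I₀∕A⟧ = πn`; and (d2a′) `r_P(I₀∕A) ≠ 0` — the letters `(A hAinv hAirr hHom0 hSchur)` of ★ 40″ `selfExtension_splits_of_jacquet_selfExtension` at `χ₁ := 𝟙 ⊗ θ₂`.
[cite: Casselman1995, Thm 3.2.4, Cor. 6.3.9, Cor. 7.1.2] [cite: BernsteinZelevinsky1977, Prop. 1.9 (b)] [cite: Bump1997, Proposition 4.2.4] -/
theorem exists_realisation_schurPair (t : ParabolicTriple G) [LocallyCompactSpace t.P] (hδ : ∀ (n : G) (hn : n ∈ t.N), deltaChar t.P ⟨n, t.N_le hn⟩ = 1) {θ₁ θ₂ : ↥t.M →* ℂˣ}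
    (hadm : (normalizedInd t ((Representation.trivial ℂ ↥t.M ℂ).twist θ₂)).IsAdmissible) {K : Subgroup G} (hKo : IsOpen (K : Set G)) (hKc : IsCompact (K : Set G))
    (hlen : ∀ N₁ N₂ : Subrepresentation (normalizedInd t ((Representation.trivial ℂ ↥t.M ℂ).twist θ₂)), ¬ (⊥ < N₁ ∧ N₁ < N₂ ∧ N₂ < ⊤))
    {πs πn : IrrClass G} (hne : πs ≠ πn)
    (hJH : ∀ c : IrrClass G, c.IsConstituentOf (normalizedInd t ((Representation.trivial ℂ ↥t.M ℂ).twist θ₂)) ↔ (c = πn ∨ c = πs))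
    (hs : ∃ r : SmoothIrrep G, IrrClass.mk r = πs ∧ Nonempty ((r.ρ.normalizedJacquet t).Equiv ((Representation.trivial ℂ ↥t.M ℂ).twist θ₂)))
    (hn : ∃ r : SmoothIrrep G, IrrClass.mk r = πn ∧ Nonempty ((r.ρ.normalizedJacquet t).Equiv ((Representation.trivial ℂ ↥t.M ℂ).twist θ₁))) :
    ∃ (A : Submodule ℂ (SmoothInd t.P (Representation.twist (((Representation.trivial ℂ ↥t.M ℂ).twist θ₂).comp t.proj) (rootDeltaChar t.P))))
      (hAinv : ∀ g, A ≤ A.comap (normalizedInd t ((Representation.trivial ℂ ↥t.M ℂ).twist θ₂) g)),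
      (∀ B : Submodule ℂ _, B ≤ A → (∀ g, B ≤ B.comap (normalizedInd t ((Representation.trivial ℂ ↥t.M ℂ).twist θ₂) g)) → B = ⊥ ∨ B = A) ∧
      (∀ ψ : IntertwiningMap ((normalizedInd t ((Representation.trivial ℂ ↥t.M ℂ).twist θ₂)).subrepresentation A hAinv)
        ((normalizedInd t ((Representation.trivial ℂ ↥t.M ℂ).twist θ₂)).quotient A hAinv), ψ = 0) ∧
      Module.finrank ℂ (IntertwiningMap ((normalizedInd t ((Representation.trivial ℂ ↥t.M ℂ).twist θ₂)).subrepresentation A hAinv)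
        ((normalizedInd t ((Representation.trivial ℂ ↥t.M ℂ).twist θ₂)).subrepresentation A hAinv)) = 1 ∧
      (∃ (hirr : ((normalizedInd t ((Representation.trivial ℂ ↥t.M ℂ).twist θ₂)).subrepresentation A hAinv).IsIrreducible)
          (hsm : ((normalizedInd t ((Representation.trivial ℂ ↥t.M ℂ).twist θ₂)).subrepresentation A hAinv).IsSmooth),
        IrrClass.mk (SmoothIrrep.mk ↥A _ hirr hsm) = πs) ∧
      (∃ (hirr : ((normalizedInd t ((Representation.trivial ℂ ↥t.M ℂ).twist θ₂)).quotient A hAinv).IsIrreducible)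
          (hsm : ((normalizedInd t ((Representation.trivial ℂ ↥t.M ℂ).twist θ₂)).quotient A hAinv).IsSmooth),
        IrrClass.mk (SmoothIrrep.mk (_ ⧸ A) _ hirr hsm) = πn) ∧
      Nontrivial (t.restrict ((normalizedInd t ((Representation.trivial ℂ ↥t.M ℂ).twist θ₂)).quotient A hAinv)).Coinvariants := by
  set I₀ := normalizedInd t ((Representation.trivial ℂ ↥t.M ℂ).twist θ₂) with hI₀
  have hI : I₀.IsSmooth := hadm.isSmooth
  -- REALISE `πs ↪ I₀`
  obtain ⟨r, hr, ⟨e⟩⟩ := hs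
  haveI : r.ρ.IsIrreducible := r.isIrreducible
  obtain ⟨f, hf⟩ := r.ρ.exists_injective_intertwiningMap_normalizedInd_of_normalizedJacquet_equiv t r.isSmooth hδ e
  set A : Submodule ℂ _ := LinearMap.range f.toLinearMap with hA
  have hAinv : ∀ g, A ≤ A.comap (I₀ g) := range_le_comap_of_intertwiningMap f
  let N : Subrepresentation I₀ := ⟨A, fun g _ hv => hAinv g hv⟩
  -- the sub is irreducible smooth of class `πs`
  have hirrA : (I₀.subrepresentation A hAinv).IsIrreducible := isIrreducible_subrepresentation_range f hf
  have hsmA : (I₀.subrepresentation A hAinv).IsSmooth := hI.toRepresentation N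
  obtain ⟨eA⟩ := nonempty_equiv_subrepresentation_range f hf
  have hclsA : IrrClass.mk (SmoothIrrep.mk ↥A (I₀.subrepresentation A hAinv) hirrA hsmA) = πs := by
    rw [← hr]
    exact (IrrClass.mk_eq_mk_of_equiv (r₁ := r) (r₂ := SmoothIrrep.mk ↥A (I₀.subrepresentation A hAinv) hirrA hsmA) eA).symm
  -- the quotient is irreducible smooth of class `πn`
  have hb : A ≠ ⊥ := range_ne_bot_of_injective f hf
  have ht : A ≠ ⊤ := range_ne_top_of_constituents_pair hJH hne.symm f hf
  have hirrQ : (I₀.quotient A hAinv).IsIrreducible := isIrreducible_quotient_of_forall_not_lt_lt hlen A hAinv hb ht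
  have hsmQ : (I₀.quotient A hAinv).IsSmooth := hI.quotientRep N
  have hJH' : ∀ c : IrrClass G, c.IsConstituentOf I₀ ↔ (c = πs ∨ c = πn) := fun c => (hJH c).trans Or.comm
  have hclsQ : IrrClass.mk (SmoothIrrep.mk (_ ⧸ A) (I₀.quotient A hAinv) hirrQ hsmQ) = πn :=
    mk_quotient_eq_of_mk_subrepresentation_eq hI hJH' hne A hAinv hirrA hsmA hirrQ hsmQ hclsA
  refine ⟨A, hAinv, fun B hB hBinv => forall_le_range_eq_bot_or_eq f B hB hBinv, fun ψ => ?_, ?_, ⟨hirrA, hsmA, hclsA⟩, ⟨hirrQ, hsmQ, hclsQ⟩, ?_⟩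
  · exact intertwiningMap_subrepresentation_quotient_eq_zero A hAinv hirrA hsmA hirrQ hsmQ (by rw [hclsA, hclsQ]; exact hne) ψ
  · exact finrank_intertwiningMap_subrepresentation_self_eq_one hadm hKo hKc A hAinv hirrA
  · exact nontrivial_coinvariants_quotient_of_mk_eq t A hAinv hirrQ hsmQ hclsQ hn

end IrrClass

end Literature.NumberTheory.Automorphic

end
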